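import Summits.QuantumFields.YangMills.Theorems.ColdStartUniversalityColdStartSolutionsExistVecPicardEstimates
import HarnessLib

/-!
# Route `ColdStartUniversality` (rung input (E) of crux K_A1, stmt-QuantumFields-24809): pathwise uniqueness
# for Lipschitz SDE systems driven by a Brownian vector — bounded solutions

Helper file (seat `ym-line-csu-p1`).  The uniqueness half of Itô's theorem (Revuz–Yor IX (2.1)) for the
vector systems `dX_i = b_i(X) dt + Σₙ σ_{i n}(X) dW^{c i n}` of `…ColdStartSolutionsExistVecPicard`
(existence half, seat g2), in the case the route needs: two solutions with the SAME deterministic start,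
coordinatewise progressive with a.s. continuous and a.s. BOUNDED paths (the lattice Langevin solutions live on
the compact `SU(2)^E`, so no localisation is needed), are indistinguishable.

Proof: both solutions are fixed points of the Picard step up to indistinguishability (uniqueness of the Itô
integral gives progressive versions of their stochastic integrals, `IsItoIntegral.exists_isStronglyProgressive`),
so the contraction estimate `vecPicard_contraction` (`E sup_{s≤t}|X−Y|² ≤ C E∫₀ᵗ|X−Y|²`) and the Gronwall
step `Literature.Analysis.FunctionSpaces.ae_eq_zero_of_lintegral_iSup_sq_le` give `X_s = Y_s` a.s. for
each `s`; a.s. continuity of the paths upgrades this to indistinguishability.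

This is the first brick of the rung input (E) (`hyp_latticeErgodic`: a mixing time UNIFORM over all
cold-start solutions presupposes that they all have the same law — pathwise uniqueness, then uniqueness
in law) and of SZZ Lemma 3.2's uniqueness clause (tree named fact `LatticeLangevinWellPosed`).  No
definition, no sorry.  RECORD-rung R3 plumbing; nothing here bears on the mass gap. -/

set_option autoImplicit false

noncomputable section

namespace Summit.QuantumFields.YangMills.Theorems.ColdStartUniversality

open MeasureTheory ProbabilityTheory Filter Topology Finset
open scoped NNReal ENNReal BigOperators
open Literature.Probability.Process Literature.Analysis.FunctionSpaces

section Uniqueness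

variable {Ω : Type*} {mΩ : MeasurableSpace Ω} {P : Measure Ω} {d : ℕ}
  {W : ℝ≥0 → Ω → (Fin d → ℝ)} {ι κ : Type*} [Fintype ι] [Fintype κ]
  {b : (ι → ℝ) → ι → ℝ} {σ : (ι → ℝ) → ι → κ → ℝ} {c : ι → κ → Fin d} {K : ℝ} {x₀ : ι → ℝ}

/-- Two continuous functions on `ℝ≥0` agreeing at all rational times agree. [folklore] -/
theorem eq_of_eq_on_rat {f g : ℝ≥0 → ℝ} (hf : Continuous f) (hg : Continuous g)
    (h : ∀ q : ℚ, f ((q : ℝ).toNNReal) = g ((q : ℝ).toNNReal)) : f = g :=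
  denseRange_toNNReal_ratCast.equalizer hf hg (funext fun q => h q)

/-- **Pathwise uniqueness for Lipschitz systems, bounded solutions** (RY IX (2.1), uniqueness half, no
localisation).  On a probability space carrying a Brownian vector `W` (raw joint natural filtration `𝓕`),
let `Y, Y'` be two coordinatewise progressive, a.s. continuous, a.s. bounded processes solving
`Y_i(t) = x₀ i + ∫₀ᵗ b_i(Y_s) ds + Σₙ J i n (t)` a.s. for all `t`, with `J i n = ∫ σ_{i n}(Y) dW^{c i n}`
(tree `IsItoIntegral`), for globally Lipschitz (sum-of-squares) `b, σ`.  Then a.s. `Y_t = Y'_t` for all `t`.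
[cite: RevuzYor1999, Ch. IX Thm (2.1)] -/
theorem vecSDE_pathwise_unique_of_bounded [IsProbabilityMeasure P] (hW : IsBrownianVec W P) (hK : 0 ≤ K)
    (hb : ∀ x y : ι → ℝ, ∑ i, (b x i - b y i) ^ 2 ≤ K * ∑ i, (x i - y i) ^ 2)
    (hσ : ∀ x y : ι → ℝ, ∑ i, ∑ n, (σ x i n - σ y i n) ^ 2 ≤ K * ∑ i, (x i - y i) ^ 2)
    {Y Y' : ι → ℝ≥0 → Ω → ℝ} {J J' : ι → κ → ℝ≥0 → Ω → ℝ}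
    (hYp : ∀ i, IsStronglyProgressive hW.natFiltration (Y i))
    (hYc : ∀ᵐ ω ∂P, ∀ i, Continuous fun t => Y i t ω)
    (hY'p : ∀ i, IsStronglyProgressive hW.natFiltration (Y' i))
    (hY'c : ∀ᵐ ω ∂P, ∀ i, Continuous fun t => Y' i t ω)
    (hJ : ∀ i n, IsItoIntegral (fun s ω => σ (fun j => Y j s ω) i n) (fun s ω => W s ω (c i n)) (J i n)
        hW.natFiltration P)
    (hJ' : ∀ i n, IsItoIntegral (fun s ω => σ (fun j => Y' j s ω) i n) (fun s ω => W s ω (c i n)) (J' i n)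
        hW.natFiltration P)
    (hYeq : ∀ᵐ ω ∂P, ∀ (t : ℝ≥0) (i : ι),
      Y i t ω = x₀ i + (∫ s in (0 : ℝ)..t, b (fun j => Y j s.toNNReal ω) i) + ∑ n, J i n t ω)
    (hY'eq : ∀ᵐ ω ∂P, ∀ (t : ℝ≥0) (i : ι),
      Y' i t ω = x₀ i + (∫ s in (0 : ℝ)..t, b (fun j => Y' j s.toNNReal ω) i) + ∑ n, J' i n t ω)
    {M : ℝ} (hbd : ∀ᵐ ω ∂P, ∀ (t : ℝ≥0) (i : ι), |Y i t ω| ≤ M ∧ |Y' i t ω| ≤ M) :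
    ∀ᵐ ω ∂P, ∀ (t : ℝ≥0) (i : ι), Y i t ω = Y' i t ω := by
  classical
  -- progressive versions of the Itô integrals
  have hJv : ∀ i n, ∃ V : ℝ≥0 → Ω → ℝ,
      IsItoIntegral (fun s ω => σ (fun j => Y j s ω) i n) (fun s ω => W s ω (c i n)) V hW.natFiltration P ∧
        IsStronglyProgressive hW.natFiltration V ∧ ∀ᵐ ω ∂P, ∀ t, V t ω = J i n t ω := fun i n => by
    obtain ⟨V, h1, h2, -, h3⟩ := (hJ i n).exists_isStronglyProgressive
    exact ⟨V, h1, h2, h3⟩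
  have hJv' : ∀ i n, ∃ V : ℝ≥0 → Ω → ℝ,
      IsItoIntegral (fun s ω => σ (fun j => Y' j s ω) i n) (fun s ω => W s ω (c i n)) V hW.natFiltration P ∧
        IsStronglyProgressive hW.natFiltration V ∧ ∀ᵐ ω ∂P, ∀ t, V t ω = J' i n t ω := fun i n => by
    obtain ⟨V, h1, h2, -, h3⟩ := (hJ' i n).exists_isStronglyProgressive
    exact ⟨V, h1, h2, h3⟩
  choose JV hJV1 hJV2 hJV3 using hJv
  choose JV' hJV'1 hJV'2 hJV'3 using hJv'
  -- the Picard steps of `Y`, `Y'` with these integrals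
  set V : ι → ℝ≥0 → Ω → ℝ := fun i t ω =>
    x₀ i + timeIntegral (fun s ω => b (fun j => Y j s ω) i) t ω + ∑ n, JV i n t ω with hVdef
  set V' : ι → ℝ≥0 → Ω → ℝ := fun i t ω =>
    x₀ i + timeIntegral (fun s ω => b (fun j => Y' j s ω) i) t ω + ∑ n, JV' i n t ω with hV'def
  have hJVae : ∀ᵐ ω ∂P, ∀ i n t, JV i n t ω = J i n t ω := by
    have h := fun i => (ae_all_iff.2 fun n => hJV3 i n)
    exact (ae_all_iff.2 h).mono fun ω hω i n t => hω i n t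
  have hJV'ae : ∀ᵐ ω ∂P, ∀ i n t, JV' i n t ω = J' i n t ω := by
    have h := fun i => (ae_all_iff.2 fun n => hJV'3 i n)
    exact (ae_all_iff.2 h).mono fun ω hω i n t => hω i n t
  have hVY : ∀ᵐ ω ∂P, ∀ (t : ℝ≥0) (i : ι), V i t ω = Y i t ω := by
    filter_upwards [hYeq, hJVae] with ω hω hωJ t i
    rw [hω t i, hVdef]
    simp only [timeIntegral, hωJ]
  have hV'Y' : ∀ᵐ ω ∂P, ∀ (t : ℝ≥0) (i : ι), V' i t ω = Y' i t ω := by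
    filter_upwards [hY'eq, hJV'ae] with ω hω hωJ t i
    rw [hω t i, hV'def]
    simp only [timeIntegral, hωJ]
  -- the contraction estimate
  have hcontr := fun T : ℝ≥0 => vecPicard_contraction (x₀ := x₀) hW hK hb hσ hYp hYc hY'p hY'c
    (fun i n => ⟨hJV1 i n, hJV2 i n⟩) (fun i t ω => rfl) (fun i n => ⟨hJV'1 i n, hJV'2 i n⟩)
    (fun i t ω => rfl) T
  -- the difference process `D = |Y - Y'|`
  set D : ℝ≥0 → Ω → ℝ := fun s ω => Real.sqrt (∑ i, (Y i s ω - Y' i s ω) ^ 2) with hDdef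
  have hDsq : ∀ s ω, D s ω ^ 2 = ∑ i, (Y i s ω - Y' i s ω) ^ 2 := fun s ω =>
    Real.sq_sqrt (Finset.sum_nonneg fun _ _ => sq_nonneg _)
  have hDm : Measurable (fun p : ℝ≥0 × Ω => D p.1 p.2) := by
    have h : ∀ i, Measurable (fun p : ℝ≥0 × Ω => Y i p.1 p.2 - Y' i p.1 p.2) := fun i =>
      (IsStronglyProgressive.measurable_uncurry (hYp i)).sub (IsStronglyProgressive.measurable_uncurry (hY'p i))
    exact (Finset.measurable_sum _ fun i _ => (h i).pow_const 2).sqrt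
  have hDbd : ∀ᵐ ω ∂P, ∀ s, |D s ω| ≤ Real.sqrt (Fintype.card ι * (2 * |M|) ^ 2) := by
    filter_upwards [hbd] with ω hω s
    rw [abs_of_nonneg (Real.sqrt_nonneg _)]
    refine Real.sqrt_le_sqrt ?_
    calc ∑ i, (Y i s ω - Y' i s ω) ^ 2 ≤ ∑ _i : ι, (2 * |M|) ^ 2 := by
          refine Finset.sum_le_sum fun i _ => ?_
          have h1 := (hω s i).1
          have h2 := (hω s i).2
          have h3 : |Y i s ω - Y' i s ω| ≤ 2 * |M| :=
            (abs_sub _ _).trans (by linarith [le_abs_self M])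
          rw [← sq_abs]
          exact pow_le_pow_left₀ (abs_nonneg _) h3 2
      _ = Fintype.card ι * (2 * |M|) ^ 2 := by rw [Finset.sum_const, Finset.card_univ, nsmul_eq_mul]
  -- Gronwall: `D_s = 0` a.s. for each `s`
  have hzero : ∀ (T : ℝ≥0), ∀ s ≤ T, ∀ᵐ ω ∂P, D s ω = 0 := by
    intro T
    refine ae_eq_zero_of_lintegral_iSup_sq_le hDm hDbd (T := T)
      (C := (Fintype.card ι : ℝ≥0∞) * ENNReal.ofReal (2 * T * K) +
        8 * (Fintype.card ι : ℝ≥0∞) * (Fintype.card κ : ℝ≥0∞) ^ 2 * ENNReal.ofReal K) ?_ fun t ht => ?_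
    · exact ENNReal.add_ne_top.2 ⟨ENNReal.mul_ne_top (ENNReal.natCast_ne_top _) ENNReal.ofReal_ne_top,
        ENNReal.mul_ne_top (ENNReal.mul_ne_top (ENNReal.mul_ne_top (by norm_num) (ENNReal.natCast_ne_top _))
          (ENNReal.pow_ne_top (ENNReal.natCast_ne_top _))) ENNReal.ofReal_ne_top⟩
    · have h1 := hcontr T t ht
      have hlhs : (∫⁻ ω, ⨆ s ∈ Set.Iic t, ENNReal.ofReal (D s ω ^ 2) ∂P) =
          ∫⁻ ω, ⨆ s ∈ Set.Iic t, ENNReal.ofReal (∑ i, (V i s ω - V' i s ω) ^ 2) ∂P := by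
        refine lintegral_congr_ae ?_
        filter_upwards [hVY, hV'Y'] with ω h h'
        simp only [hDsq, h, h']
      have hrhs : (∫⁻ ω, (∫⁻ r in Set.Icc (0 : ℝ) t, ENNReal.ofReal (D r.toNNReal ω ^ 2)) ∂P) =
          ∫⁻ ω, (∫⁻ r in Set.Icc (0 : ℝ) t,
            ENNReal.ofReal (∑ i, (Y i r.toNNReal ω - Y' i r.toNNReal ω) ^ 2)) ∂P := by
        simp only [hDsq]
      rw [hlhs, hrhs]
      exact h1
  -- for each time, a.s. equality of all coordinates
  have hfix : ∀ s : ℝ≥0, ∀ᵐ ω ∂P, ∀ i, Y i s ω = Y' i s ω := by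
    intro s
    filter_upwards [hzero s s le_rfl] with ω hω i
    have h0 : ∑ j, (Y j s ω - Y' j s ω) ^ 2 = 0 := by rw [← hDsq, hω]; ring
    have := (Finset.sum_eq_zero_iff_of_nonneg fun j _ => sq_nonneg (Y j s ω - Y' j s ω)).1 h0 i
      (Finset.mem_univ _)
    exact sub_eq_zero.1 (pow_eq_zero_iff two_ne_zero |>.1 this)
  -- all rational times at once, then all times by continuity
  have hrat : ∀ᵐ ω ∂P, ∀ (q : ℚ) (i : ι), Y i ((q : ℝ).toNNReal) ω = Y' i ((q : ℝ).toNNReal) ω :=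
    ae_all_iff.2 fun q => hfix _
  filter_upwards [hrat, hYc, hY'c] with ω hq hc hc' t i
  have := eq_of_eq_on_rat (hc i) (hc' i) fun q => hq q i
  exact congrFun this t

end Uniqueness

end Summit.QuantumFields.YangMills.Theorems.ColdStartUniversality

end
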